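import Summits.AtomisticToContinuum.BoseEinsteinCondensation.Theses.BECDyadicChaining
import HarnessLib

/-!
# Crux `DyadicCoherenceDefect` (stmt-AtomisticToContinuum-13192), line `registered` (lead c2, kinetic window):
# the registered stub `stub_kineticWindowBudget` (KB, THE KINETIC WINDOW BUDGET)

Supports (does not close) stmt-AtomisticToContinuum-13192.  The stub is pure bookkeeping on the
KINETIC (Neumann–Poincaré) window `s = L/2^m ≤ s_K := c₀ (ρa)^{-1/2}` (`a = scatteringLength`,
real part): from the level ladder `T_{m-1} ≤ T_m ≤ N`, `A_m ≤ A_{m-1} + √(T_m − T_{m-1})` (stub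
S2, first hypothesis), the block kinetic bound `N ≤ T_k + (L/2^k)²/π² · ∫|∇Ψ|²` (stub K, second
hypothesis) and the kinetic budget `∫|∇Ψ|² ≤ 4πaρ(1+μ)N` for near-minimisers (stub E, third
hypothesis) it derives the window half of the crux with any total budget `b > 16 c₀/√π`.

Proof.  If `a = 0` the window top `s_K` is `0` and the window is empty.  If `a > 0`, put
`q := b√π/(16 c₀) > 1`, `1 + μ := q²` and take `ρ₀` from E at this `μ`.  For `0 < ρ < ρ₀` let
`c := q √(ρa)/√π` (so `c² = (1+μ)ρa/π` and `16 c s_K = 16 c₀ q/√π = b`) and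
`β_j := 8 ℓ_d 2^j c` on the finitely many brackets `ℓ_d 2^j ≤ s_K`, `β_j := 0` otherwise; if
`n` is the least index with `s_K < ℓ_d 2^n` then `Σ β = 8 ℓ_d c (2^n − 1) ≤ 16 c ℓ_d 2^{n-1} ≤
16 c s_K = b`.  Per level `m ≥ 1` in bracket `j` inside the window (so `β_j = 8 ℓ_d 2^j c`):
K at the parent level `m − 1` and E give `T_m − T_{m-1} ≤ N − T_{m-1} ≤ (L/2^{m-1})²/π² ·
4πaρ(1+μ) · N =: X N`, and `√X = 2 (L/2^{m-1}) c = 4 (L/2^m) c ≤ 4 ℓ_d 2^{j+1} c = β_j`, whence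
`A_m ≤ A_{m-1} + √(X N) ≤ A_{m-1} + β_j √N`.

## References

* [LSSY2005] E. H. Lieb, R. Seiringer, J. P. Solovej, J. Yngvason, *The Mathematics of the Bose
  Gas and its Condensation*, Oberwolfach Seminars 34, Birkhäuser (2005), Ch. 5 (5.15)–(5.17)
  (localisation of the kinetic energy into boxes, Neumann gap `π²/ℓ²`).
-/

noncomputable section

open Filter MeasureTheory
open scoped ENNReal NNReal BigOperators

namespace Summit.AtomisticToContinuum.BoseEinsteinCondensation.Cruxes.DyadicCoherenceDefect.Birth

open Literature.MathematicalPhysics.QuantumManyBody.BoseGas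
open Summit.AtomisticToContinuum.BoseEinsteinCondensation.Theses

namespace StubKineticWindowBudget

/-! ### Real-analysis bookkeeping -/

/-- The per-level budget inequality on the kinetic window: for a level `m ≥ 1` in bracket `j`
(`ℓ_d 2^j ≤ L/2^m < ℓ_d 2^{j+1}`) and `c ≥ 0` with `c² = (1+μ)ρa/π`, the square root of the
parent's kinetic deficit coefficient `X = (L/2^{m-1})²/π² · 4πaρ(1+μ)` is
`√X = 4 (L/2^m) c ≤ 8 ℓ_d 2^j c`. [cite: LSSY2005, Ch. 5 (5.15)–(5.17)] -/
theorem sqrt_budget_le {L ℓd c a ρ μ : ℝ} {m j : ℕ} (hℓd : 0 < ℓd) (hc : 0 ≤ c)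
    (hcsq : c ^ 2 = (1 + μ) * (ρ * a) / Real.pi) (hm : 1 ≤ m)
    (hj1 : ℓd * 2 ^ j ≤ L / 2 ^ m) (hj2 : L / 2 ^ m < ℓd * 2 ^ (j + 1)) :
    Real.sqrt ((L / 2 ^ (m - 1)) ^ 2 / Real.pi ^ 2 * (4 * Real.pi * a * ρ * (1 + μ))) ≤
      8 * ℓd * 2 ^ j * c := by
  obtain ⟨k, rfl⟩ : ∃ k, m = k + 1 := ⟨m - 1, by omega⟩
  rw [Nat.add_sub_cancel]
  have hπ : Real.pi ≠ 0 := Real.pi_pos.ne'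
  have hk : L / 2 ^ k = 2 * (L / 2 ^ (k + 1)) := by
    rw [pow_succ]
    field_simp
  rw [hk]
  generalize L / 2 ^ (k + 1) = s at hj1 hj2 ⊢
  have hs0 : 0 ≤ s := le_trans (by positivity) hj1
  have hκ : 0 ≤ (1 + μ) * (ρ * a) / Real.pi := by
    rw [← hcsq]
    exact sq_nonneg c
  have h2s : s ≤ 2 * (ℓd * 2 ^ j) := by
    rw [pow_succ] at hj2
    linarith
  have hX : (2 * s) ^ 2 / Real.pi ^ 2 * (4 * Real.pi * a * ρ * (1 + μ)) ≤
      (8 * ℓd * 2 ^ j * c) ^ 2 := by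
    calc (2 * s) ^ 2 / Real.pi ^ 2 * (4 * Real.pi * a * ρ * (1 + μ))
        = 16 * s ^ 2 * ((1 + μ) * (ρ * a) / Real.pi) := by
          field_simp
          ring
      _ ≤ 16 * (2 * (ℓd * 2 ^ j)) ^ 2 * ((1 + μ) * (ρ * a) / Real.pi) :=
          mul_le_mul_of_nonneg_right
            (mul_le_mul_of_nonneg_left (pow_le_pow_left₀ hs0 h2s 2) (by norm_num)) hκ
      _ = (8 * ℓd * 2 ^ j * c) ^ 2 := by
          rw [show (8 * ℓd * 2 ^ j * c) ^ 2 = 64 * (ℓd * 2 ^ j) ^ 2 * c ^ 2 by ring, hcsq]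
          ring
  calc Real.sqrt ((2 * s) ^ 2 / Real.pi ^ 2 * (4 * Real.pi * a * ρ * (1 + μ)))
      ≤ Real.sqrt ((8 * ℓd * 2 ^ j * c) ^ 2) := Real.sqrt_le_sqrt hX
    _ = 8 * ℓd * 2 ^ j * c := Real.sqrt_sq (by positivity)

/-! ### The `ℝ≥0∞` step -/

/-- The defect step in `ℝ≥0∞` (kinetic form): from the block kinetic bound at the parent level
`N ≤ T_k + p · Kin`, the kinetic budget `Kin ≤ K N`, the ladder `T_{k+1} ≤ N`,
`A_{k+1} ≤ A_k + √(T_{k+1} − T_k)` and `√(pK) ≤ b` conclude `A_{k+1} ≤ A_k + b √N`.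
[cite: LSSY2005, Ch. 5 (5.15)–(5.17)] -/
theorem defect_step {Tk Tk1 Ak Ak1 Kin : ℝ≥0∞} {N : ℕ} {p K b : ℝ} (hp : 0 ≤ p) (hK : 0 ≤ K)
    (hTN : Tk1 ≤ N) (hA : Ak1 ≤ Ak + (Tk1 - Tk) ^ (1 / 2 : ℝ))
    (hNT : (N : ℝ≥0∞) ≤ Tk + ENNReal.ofReal p * Kin) (hKin : Kin ≤ ENNReal.ofReal (K * N))
    (hb : Real.sqrt (p * K) ≤ b) :
    Ak1 ≤ Ak + ENNReal.ofReal b * (N : ℝ≥0∞) ^ (1 / 2 : ℝ) := by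
  -- adapted from `StubWindowBudget.defect_le` (Theorems/BECDyadicChainingDyadicCoherenceDefectWindowBudget)
  have hX : 0 ≤ p * K := mul_nonneg hp hK
  have h1 : Tk1 - Tk ≤ ENNReal.ofReal (p * K * N) := by
    calc Tk1 - Tk ≤ (N : ℝ≥0∞) - Tk := tsub_le_tsub_right hTN Tk
      _ ≤ ENNReal.ofReal p * Kin := tsub_le_iff_left.mpr hNT
      _ ≤ ENNReal.ofReal p * ENNReal.ofReal (K * N) := mul_le_mul' le_rfl hKin
      _ = ENNReal.ofReal (p * K * N) := by rw [← ENNReal.ofReal_mul hp, mul_assoc]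
  have h2 : (Tk1 - Tk) ^ (1 / 2 : ℝ) ≤ ENNReal.ofReal b * (N : ℝ≥0∞) ^ (1 / 2 : ℝ) := by
    calc (Tk1 - Tk) ^ (1 / 2 : ℝ) ≤ (ENNReal.ofReal (p * K * N)) ^ (1 / 2 : ℝ) :=
          ENNReal.rpow_le_rpow h1 (by norm_num)
      _ = ENNReal.ofReal (Real.sqrt (p * K)) * (N : ℝ≥0∞) ^ (1 / 2 : ℝ) := by
          rw [ENNReal.ofReal_mul hX, ENNReal.mul_rpow_of_nonneg _ _ (by norm_num : (0 : ℝ) ≤ 1 / 2),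
            ENNReal.ofReal_natCast, ENNReal.ofReal_rpow_of_nonneg hX (by norm_num),
            Real.sqrt_eq_rpow]
      _ ≤ ENNReal.ofReal b * (N : ℝ≥0∞) ^ (1 / 2 : ℝ) :=
          mul_le_mul' (ENNReal.ofReal_le_ofReal hb) le_rfl
  exact hA.trans (add_le_add le_rfl h2)

end StubKineticWindowBudget

open StubKineticWindowBudget in
/-- **Stub KB (M): the kinetic window budget** — see `KineticWindowBudget`; hypotheses S2, K, E in expanded
form.  On the kinetic window `L/2^m ≤ c₀ (ρa)^{-1/2}` the parent block's Neumann–Poincaré bound (K)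
and the kinetic budget `∫|∇Ψ|² ≤ 4πaρ(1+μ)N` (E) give `√(T_m − T_{m-1}) ≤ 4 (L/2^m) √((1+μ)ρa/π) √N`,
dominated on bracket `j` by `β_j = 8 ℓ_d 2^j √((1+μ)ρa/π)`, a finitely supported budget with
`Σ β ≤ 16 c₀ √((1+μ)/π) ≤ b` for `1 + μ = (b√π/(16c₀))²`. [cite: LSSY2005, Ch. 5 (5.15)–(5.17)] -/
theorem stub_kineticWindowBudget :
    (∀ (N : ℕ) (L : ℝ) (Ψ : TrialState N L) (m : ℕ), 1 ≤ m →
      let φ : (m : ℕ) → (Fin 3 → Fin (2 ^ m)) → EuclideanSpace ℝ (Fin 3) → ℂ := fun m i =>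
        Set.indicator {x : EuclideanSpace ℝ (Fin 3) | ∀ k : Fin 3, x k ∈
            Set.Ioo (((i k : ℕ) : ℝ) * (L / 2 ^ m)) ((((i k : ℕ) : ℝ) + 1) * (L / 2 ^ m))}
          (fun _ => ((Real.sqrt ((L / 2 ^ m) ^ 3))⁻¹ : ℂ))
      let T : ℕ → ℝ≥0∞ := fun m => ∑ i : Fin 3 → Fin (2 ^ m), occupation N (φ m i) Ψ.ψ
      let A : ℕ → ℝ≥0∞ := fun m => (8 : ℝ≥0∞) ^ (-(m : ℝ) / 2) *
        ∑ i : Fin 3 → Fin (2 ^ m), (occupation N (φ m i) Ψ.ψ) ^ (1 / 2 : ℝ)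
      T (m - 1) ≤ T m ∧ T m ≤ N ∧ A m ≤ A (m - 1) + (T m - T (m - 1)) ^ (1 / 2 : ℝ)) →
    (∀ (N : ℕ) (L : ℝ) (Ψ : TrialState N L) (k : ℕ),
      let φ : (m : ℕ) → (Fin 3 → Fin (2 ^ m)) → EuclideanSpace ℝ (Fin 3) → ℂ := fun m i =>
        Set.indicator {x : EuclideanSpace ℝ (Fin 3) | ∀ k : Fin 3, x k ∈
            Set.Ioo (((i k : ℕ) : ℝ) * (L / 2 ^ m)) ((((i k : ℕ) : ℝ) + 1) * (L / 2 ^ m))}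
          (fun _ => ((Real.sqrt ((L / 2 ^ m) ^ 3))⁻¹ : ℂ))
      (N : ℝ≥0∞) ≤ (∑ i : Fin 3 → Fin (2 ^ k), occupation N (φ k i) Ψ.ψ) +
        ENNReal.ofReal ((L / 2 ^ k) ^ 2 / Real.pi ^ 2) * ∫⁻ X, kineticDensity Ψ.ψ X) →
    (∀ v : ℝ → ℝ≥0∞, IsRepulsiveFiniteRange v → 0 < scatteringLength v → ∀ μ : ℝ, 0 < μ →
      ∃ ρ₀ : ℝ, 0 < ρ₀ ∧ ∀ ρ : ℝ, 0 < ρ → ρ < ρ₀ → ∀ᶠ N : ℕ in atTop,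
        ∀ Ψ : TrialState N (sideLength ρ N),
          energy v Ψ ≤ groundStateEnergy v N (sideLength ρ N) + 1 →
            ∫⁻ X, kineticDensity Ψ.ψ X ≤
              ENNReal.ofReal (4 * Real.pi * (scatteringLength v).toReal * ρ * (1 + μ) * N)) →
    ∀ v : ℝ → ℝ≥0∞, IsRepulsiveFiniteRange v → 0 < scatteringLength v →
      ∀ c₀ : ℝ, 0 < c₀ → ∀ b : ℝ, 16 * c₀ / Real.sqrt Real.pi < b → ∀ ℓd : ℝ, 0 < ℓd →
      ∃ ρ₀ : ℝ, 0 < ρ₀ ∧ ∀ ρ : ℝ, 0 < ρ → ρ < ρ₀ →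
        ∃ β : ℕ → ℝ, (∀ j, 0 ≤ β j) ∧ Summable β ∧ ∑' j, β j ≤ b ∧ ∀ᶠ N : ℕ in atTop,
          let a : ℝ := (scatteringLength v).toReal
          let L : ℝ := sideLength ρ N
          let φ : (m : ℕ) → (Fin 3 → Fin (2 ^ m)) → EuclideanSpace ℝ (Fin 3) → ℂ := fun m i =>
            Set.indicator {x : EuclideanSpace ℝ (Fin 3) | ∀ k : Fin 3, x k ∈
                Set.Ioo (((i k : ℕ) : ℝ) * (L / 2 ^ m)) ((((i k : ℕ) : ℝ) + 1) * (L / 2 ^ m))}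
              (fun _ => ((Real.sqrt ((L / 2 ^ m) ^ 3))⁻¹ : ℂ))
          ∃ δ : ℝ≥0∞, 0 < δ ∧ ∀ Ψ : TrialState N L, energy v Ψ ≤ groundStateEnergy v N L + δ →
            let A : ℕ → ℝ≥0∞ := fun m => (8 : ℝ≥0∞) ^ (-(m : ℝ) / 2) *
              ∑ i : Fin 3 → Fin (2 ^ m), (occupation N (φ m i) Ψ.ψ) ^ (1 / 2 : ℝ)
            ∀ m j : ℕ, 1 ≤ m → ℓd * 2 ^ j ≤ L / 2 ^ m → L / 2 ^ m < ℓd * 2 ^ (j + 1) →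
              L / 2 ^ m ≤ c₀ * (ρ * a) ^ (-(1 : ℝ) / 2) →
              A m ≤ A (m - 1) + ENNReal.ofReal (β j) * (N : ℝ≥0∞) ^ (1 / 2 : ℝ) := by
  intro hLI hK hE v hv ha c₀ hc₀ b hb ℓd hℓd
  have hπ : 0 < Real.pi := Real.pi_pos
  have hb0 : 0 < b := lt_trans (by positivity) hb
  obtain ha0 | hapos := eq_or_lt_of_le (@ENNReal.toReal_nonneg (scatteringLength v))
  · -- `a = 0`: the window top `c₀ (ρa)^{-1/2}` is `0`, the window is empty.
    refine ⟨1, one_pos, fun ρ _ _ => ⟨fun _ => 0, fun _ => le_rfl, summable_zero,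
      by rw [tsum_zero]; exact hb0.le, Eventually.of_forall fun N => ?_⟩⟩
    dsimp only
    refine ⟨1, one_pos, fun Ψ _ m j _ h1 _ hwin => ?_⟩
    exfalso
    have h0 : (ρ * (scatteringLength v).toReal) ^ (-(1 : ℝ) / 2) = 0 := by
      rw [← ha0, mul_zero, Real.zero_rpow (by norm_num)]
    rw [h0, mul_zero] at hwin
    have h2 : 0 < ℓd * 2 ^ j := by positivity
    linarith
  · -- `a > 0`.
    obtain ⟨q, hq, hq1⟩ : ∃ q : ℝ, q = b * Real.sqrt Real.pi / (16 * c₀) ∧ 1 < q :=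
      ⟨_, rfl, (one_lt_div (by positivity)).mpr ((div_lt_iff₀ (Real.sqrt_pos.mpr hπ)).mp hb)⟩
    have hq0 : 0 < q := one_pos.trans hq1
    obtain ⟨μ, hμ, hμq⟩ : ∃ μ : ℝ, 0 < μ ∧ 1 + μ = q ^ 2 := ⟨q ^ 2 - 1, by nlinarith, by ring⟩
    obtain ⟨ρ₀, hρ₀, hEρ⟩ := hE v hv ha μ hμ
    generalize (scatteringLength v).toReal = a at hEρ hapos ⊢
    refine ⟨ρ₀, hρ₀, fun ρ hρ hρρ₀ => ?_⟩
    have hρa : 0 < ρ * a := mul_pos hρ hapos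
    obtain ⟨sK, hsK, hsK0⟩ : ∃ sK : ℝ, sK = c₀ * (ρ * a) ^ (-(1 : ℝ) / 2) ∧ 0 < sK :=
      ⟨_, rfl, by positivity⟩
    have hr : (ρ * a) ^ (-(1 : ℝ) / 2) = (Real.sqrt (ρ * a))⁻¹ := by
      rw [Real.sqrt_eq_rpow, ← Real.rpow_neg hρa.le]
      norm_num
    -- the budget scale `c = q √(ρa)/√π`: `c² = (1+μ)ρa/π` and `16 c s_K = b`
    obtain ⟨c, hc0, hcsq, hkey⟩ : ∃ c : ℝ, 0 ≤ c ∧ c ^ 2 = (1 + μ) * (ρ * a) / Real.pi ∧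
        16 * c * sK = b := by
      refine ⟨q * Real.sqrt (ρ * a) / Real.sqrt Real.pi, by positivity, ?_, ?_⟩
      · rw [div_pow, mul_pow, Real.sq_sqrt hρa.le, Real.sq_sqrt hπ.le, hμq]
      · have h1 : Real.sqrt (ρ * a) ≠ 0 := (Real.sqrt_pos.mpr hρa).ne'
        have h2 : Real.sqrt Real.pi ≠ 0 := (Real.sqrt_pos.mpr hπ).ne'
        have h3 : c₀ ≠ 0 := hc₀.ne'
        rw [hsK, hr, hq]
        field_simp
    -- the window brackets are the `j < n`, `n` least with `s_K < ℓ_d 2^n`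
    obtain ⟨n, hn, hmin⟩ : ∃ n : ℕ, sK < ℓd * 2 ^ n ∧ ∀ j, j < n → ℓd * 2 ^ j ≤ sK := by
      classical
      have hex : ∃ n : ℕ, sK < ℓd * 2 ^ n := by
        obtain ⟨n, hn⟩ := pow_unbounded_of_one_lt (sK / ℓd) (one_lt_two : (1 : ℝ) < 2)
        exact ⟨n, (div_lt_iff₀' hℓd).mp hn⟩
      exact ⟨Nat.find hex, Nat.find_spec hex, fun j hj => not_lt.mp (Nat.find_min hex hj)⟩
    have hzero : ∀ j ∉ Finset.range n,
        (if ℓd * 2 ^ j ≤ sK then 8 * ℓd * 2 ^ j * c else 0) = 0 := by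
      intro j hj
      rw [Finset.mem_range, not_lt] at hj
      have : ℓd * 2 ^ n ≤ ℓd * 2 ^ j :=
        mul_le_mul_of_nonneg_left (pow_le_pow_right₀ one_le_two hj) hℓd.le
      exact if_neg (not_le.mpr (by linarith))
    refine ⟨fun j => if ℓd * 2 ^ j ≤ sK then 8 * ℓd * 2 ^ j * c else 0, fun j => ?_,
      summable_of_ne_finset_zero hzero, ?_, ?_⟩
    · -- `β ≥ 0`
      dsimp only
      split_ifs
      · positivity
      · exact le_rfl
    · -- `Σ β ≤ b`
      rw [tsum_eq_sum hzero]
      calc ∑ j ∈ Finset.range n, (if ℓd * 2 ^ j ≤ sK then 8 * ℓd * 2 ^ j * c else 0)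
          ≤ ∑ j ∈ Finset.range n, 8 * ℓd * c * 2 ^ j := Finset.sum_le_sum fun j _ => by
            split_ifs
            · exact le_of_eq (by ring)
            · positivity
        _ = 8 * ℓd * c * (2 ^ n - 1) := by
            rw [← Finset.mul_sum, geom_sum_eq (by norm_num : (2 : ℝ) ≠ 1)]
            norm_num
        _ ≤ b := by
            cases n with
            | zero => norm_num; exact hb0.le
            | succ k =>
              have hk := hmin k (Nat.lt_succ_self k)
              calc 8 * ℓd * c * (2 ^ (k + 1) - 1) ≤ 8 * ℓd * c * 2 ^ (k + 1) :=
                    mul_le_mul_of_nonneg_left (by linarith) (by positivity)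
                _ = 16 * c * (ℓd * 2 ^ k) := by
                    rw [pow_succ]
                    ring
                _ ≤ 16 * c * sK := mul_le_mul_of_nonneg_left hk (by positivity)
                _ = b := hkey
    · -- the per-level step, eventually in `N`
      filter_upwards [hEρ ρ hρ hρρ₀] with N hN
      dsimp only
      generalize sideLength ρ N = L at hN ⊢
      refine ⟨1, one_pos, fun Ψ hΨ m j hm hj1 hj2 hwin => ?_⟩
      rw [← hsK] at hwin
      rw [if_pos (hj1.trans hwin)]
      obtain ⟨-, hTN, hA⟩ := hLI N L Ψ m hm
      have hKk := hK N L Ψ (m - 1)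
      dsimp only at hKk
      exact defect_step (by positivity) (by positivity) hTN hA hKk (hN Ψ hΨ)
        (sqrt_budget_le hℓd hc0 hcsq hm hj1 hj2)

end Summit.AtomisticToContinuum.BoseEinsteinCondensation.Cruxes.DyadicCoherenceDefect.Birth

end
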